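import Mathlib
import Summits.Parity.GeneralizedHardyLittlewood.Theorems.LiouvilleMADFanDecorrelationStubFanFromLaws

/-!
# Transfer `HeightLaw → FanDecorrelation` (line `SketchIdeator5`, stub `stub_transfer`)

Stub `stub_transfer` of the crux `FanDecorrelation`
(`Summit.Parity.GeneralizedHardyLittlewood.Theses.LiouvilleMAD`), line `SketchIdeator5`
(idea `mellin-height-law`): the lag-scale TRANSFER, pure bookkeeping.

Notation (informal; nothing is defined in this file): `Q = ⌊√M⌋ + 1`,
`λ = ArithmeticFunction.liouville`, `D(h) = Σ_{(m,m') ∈ (M,2M]², m − m' = h} λ(mn+c) λ(m'n'+c)`,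
`R_k = Σ_{j ∈ [Q,2Q)} D(kj)` (the crux's fan sum) and, for a profile `φ`, centre `P`, width `D`,
the smooth fan `SF_φ(P,D) = Σ_{j ∈ [1,2M]} φ((j−P)/D)·D(kj)`.

`stub_transfer`: a dyadic smooth partition of the sharp window on the integers
(`1_{[Q,2Q)}(j) = Σ_{i<N} φ₁((j−Q)/s_i) − Σ_{i<N} φ₁((j−2Q)/s_i) + Σ_{ℓ<8} φ₂((j−Q−ℓQ/8)/(Q/8))`,
`2^N ≤ Q`, `s_i ∈ [1, Q/8]`, two fixed smooth profiles supported in `[−2,2]`) and the HEIGHT LAW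
(`|SF_φ(P,D)| ≤ C_φ M^{3/4+ϑ_φ}`, `ϑ_φ < 1/4`, for every smooth `φ` supported in `[−2,2]`, all
`1 ≤ D ≤ Q/8`, `Q ≤ P ≤ 2Q`, `k ≠ 0`, `1 ≤ n ≠ n' ≤ 2M`) imply the body of the route declaration
`FanDecorrelation`.  Proof: for `M ≥ 64`, `[Q,2Q) ⊆ [1,2M]`, so `R_k` is the signed sum of the
`2N + 8` smooth fans given by the partition, each `≤ C₀ M^{3/4+ϑ₀}` (`ϑ₀ = max(ϑ₁,ϑ₂,0)`,
`C₀ = max(C₁,C₂,0)`); `2N + 8 ≤ (4/(ε log 2) + 8)·M^{ε}` with `ε = (1/4 − ϑ₀)/2` because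
`N log 2 ≤ log Q ≤ Q^ε/ε ≤ 2M^ε/ε`; `M < 64` by the trivial bound `|R_k| ≤ Q·M² ≤ 36864`
(`FanFromLaws.abs_fanSum_le`).

Design: a `Theorems` support file declares no definitions; the combinatorial lemmas are stated for
an arbitrary lag sequence `a : ℕ → ℝ` (in the stub, `a j = D(kj)`).
-/

open scoped BigOperators

namespace Summit.Parity.GeneralizedHardyLittlewood.Theorems.FanDecorrelation.Transfer

open Finset

/-- The sharp window as an indicator on `[1,2M]`: for `2Q ≤ 2M + 1`,
`Σ_{j ∈ [Q,2Q)} a_j = Σ_{j ∈ [1,2M]} 1_{[Q,2Q)}(j)·a_j` (for `Q = 0` both sides vanish). [folklore] -/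
theorem sum_Ico_eq_sum_Icc_ite (a : ℕ → ℝ) {Q M : ℕ} (hQM : 2 * Q ≤ 2 * M + 1) :
    ∑ j ∈ Ico Q (2 * Q), a j =
      ∑ j ∈ Icc 1 (2 * M), (if (Q : ℤ) ≤ (j : ℤ) ∧ (j : ℤ) < 2 * Q then (1 : ℝ) else 0) * a j := by
  have hsub : Ico Q (2 * Q) = (Icc 1 (2 * M)).filter (fun j => Q ≤ j ∧ j < 2 * Q) := by
    ext j
    simp only [mem_Ico, mem_filter, mem_Icc]
    omega
  rw [hsub, sum_filter]
  refine sum_congr rfl fun j _ => ?_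
  by_cases h : Q ≤ j ∧ j < 2 * Q
  · have h' : (Q : ℤ) ≤ (j : ℤ) ∧ (j : ℤ) < 2 * Q := ⟨by exact_mod_cast h.1, by exact_mod_cast h.2⟩
    rw [if_pos h, if_pos h', one_mul]
  · have h' : ¬ ((Q : ℤ) ≤ (j : ℤ) ∧ (j : ℤ) < 2 * Q) := by
      rintro ⟨h1, h2⟩
      exact h ⟨by exact_mod_cast h1, by exact_mod_cast h2⟩
    rw [if_neg h, if_neg h', zero_mul]

/-- Expanding the partitioned window against a lag sequence: if
`1_{[Q,2Q)}(j) = Σ_{i<N} φ₁((j−Q)/s_i) − Σ_{i<N} φ₁((j−2Q)/s_i) + Σ_{ℓ<8} φ₂((j−Q−ℓQ/8)/(Q/8))`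
for every integer `j`, then `Σ_j 1_{[Q,2Q)}(j) a_j` is the corresponding signed sum of `2N + 8`
smooth fans. [folklore] -/
theorem sum_ite_mul_eq_of_partition (a : ℕ → ℝ) (φ₁ φ₂ : ℝ → ℝ) (Q M N : ℕ) (s : ℕ → ℝ)
    (hpart : ∀ j : ℤ, (if (Q : ℤ) ≤ j ∧ j < 2 * Q then (1 : ℝ) else 0) =
      (∑ i ∈ range N, φ₁ (((j : ℝ) - Q) / s i)) -
        (∑ i ∈ range N, φ₁ (((j : ℝ) - 2 * Q) / s i)) +
        ∑ l ∈ range 8, φ₂ (((j : ℝ) - ((Q : ℝ) + l * ((Q : ℝ) / 8))) / ((Q : ℝ) / 8))) :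
    ∑ j ∈ Icc 1 (2 * M), (if (Q : ℤ) ≤ (j : ℤ) ∧ (j : ℤ) < 2 * Q then (1 : ℝ) else 0) * a j =
      (∑ i ∈ range N, ∑ j ∈ Icc 1 (2 * M), φ₁ (((j : ℝ) - Q) / s i) * a j) -
        (∑ i ∈ range N, ∑ j ∈ Icc 1 (2 * M), φ₁ (((j : ℝ) - 2 * Q) / s i) * a j) +
        ∑ l ∈ range 8, ∑ j ∈ Icc 1 (2 * M),
          φ₂ (((j : ℝ) - ((Q : ℝ) + l * ((Q : ℝ) / 8))) / ((Q : ℝ) / 8)) * a j := by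
  have hj : ∀ j ∈ Icc 1 (2 * M),
      (if (Q : ℤ) ≤ (j : ℤ) ∧ (j : ℤ) < 2 * Q then (1 : ℝ) else 0) * a j =
        (∑ i ∈ range N, φ₁ (((j : ℝ) - Q) / s i) * a j) -
          (∑ i ∈ range N, φ₁ (((j : ℝ) - 2 * Q) / s i) * a j) +
          ∑ l ∈ range 8, φ₂ (((j : ℝ) - ((Q : ℝ) + l * ((Q : ℝ) / 8))) / ((Q : ℝ) / 8)) * a j := by
    intro j _
    have h := hpart (j : ℤ)
    simp only [Int.cast_natCast] at h
    rw [h, add_mul, sub_mul, sum_mul, sum_mul, sum_mul]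
  rw [sum_congr rfl hj, sum_add_distrib, sum_sub_distrib, sum_comm]
  congr 1
  · congr 1
    exact sum_comm
  · exact sum_comm

/-- Absorbing the log-count of pieces: if `2^N ≤ Q ≤ 2M`, `1 ≤ M`, `0 < ε ≤ 1`, then
`2N + 8 ≤ (4/(ε·log 2) + 8)·M^ε` (`N log 2 ≤ log Q ≤ Q^ε/ε ≤ 2M^ε/ε`). [folklore] -/
theorem two_mul_add_eight_le {N : ℕ} {Q M ε : ℝ} (hN : (2 : ℝ) ^ N ≤ Q) (hQ : Q ≤ 2 * M)
    (hM : 1 ≤ M) (hε : 0 < ε) (hε1 : ε ≤ 1) :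
    2 * (N : ℝ) + 8 ≤ (4 / (ε * Real.log 2) + 8) * M ^ ε := by
  have hlog2 : 0 < Real.log 2 := Real.log_pos one_lt_two
  have hQpos : 0 < Q := lt_of_lt_of_le (by positivity) hN
  have hMε : 1 ≤ M ^ ε := Real.one_le_rpow hM hε.le
  -- `N log 2 ≤ log Q`
  have h1 : (N : ℝ) * Real.log 2 ≤ Real.log Q := by
    rw [← Real.log_pow]
    exact Real.log_le_log (by positivity) hN
  -- `log Q ≤ Q^ε / ε ≤ (2M)^ε/ε ≤ 2 M^ε / ε`
  have h2 : Real.log Q ≤ Q ^ ε / ε := Real.log_le_rpow_div hQpos.le hε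
  have h3 : Q ^ ε ≤ 2 * M ^ ε := by
    calc Q ^ ε ≤ (2 * M) ^ ε := Real.rpow_le_rpow hQpos.le hQ hε.le
      _ = 2 ^ ε * M ^ ε := Real.mul_rpow (by norm_num) (by linarith)
      _ ≤ 2 * M ^ ε := by
          refine mul_le_mul_of_nonneg_right ?_ (by linarith)
          calc (2 : ℝ) ^ ε ≤ 2 ^ (1 : ℝ) :=
                Real.rpow_le_rpow_of_exponent_le (by norm_num) hε1
            _ = 2 := Real.rpow_one 2
  have h4 : (N : ℝ) ≤ 2 * M ^ ε / (ε * Real.log 2) := by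
    rw [le_div_iff₀ (mul_pos hε hlog2)]
    calc (N : ℝ) * (ε * Real.log 2) = ((N : ℝ) * Real.log 2) * ε := by ring
      _ ≤ Real.log Q * ε := mul_le_mul_of_nonneg_right h1 hε.le
      _ ≤ (Q ^ ε / ε) * ε := mul_le_mul_of_nonneg_right h2 hε.le
      _ = Q ^ ε := by field_simp
      _ ≤ 2 * M ^ ε := h3
  calc 2 * (N : ℝ) + 8 ≤ 2 * (2 * M ^ ε / (ε * Real.log 2)) + 8 * M ^ ε := by
        have : (8 : ℝ) ≤ 8 * M ^ ε := by nlinarith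
        linarith
    _ = (4 / (ε * Real.log 2) + 8) * M ^ ε := by
        field_simp
        ring

/-- A sum of `N` terms each bounded by `B` is bounded by `N·B` in absolute value. [folklore] -/
theorem abs_sum_range_le {N : ℕ} {f : ℕ → ℝ} {B : ℝ} (h : ∀ i, i < N → |f i| ≤ B) :
    |∑ i ∈ range N, f i| ≤ N * B := by
  calc |∑ i ∈ range N, f i| ≤ ∑ i ∈ range N, |f i| := abs_sum_le_sum_abs _ _
    _ ≤ ∑ i ∈ range N, B := sum_le_sum fun i hi => h i (mem_range.mp hi)
    _ = N * B := by rw [sum_const, card_range, nsmul_eq_mul]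

/-- **Transfer (stub `stub_transfer`, line `SketchIdeator5` of the crux `FanDecorrelation`).**
The dyadic smooth partition of the sharp lag window on the integers (hypothesis 1 — stub
`stub_windowPartition` verbatim) and the HEIGHT LAW for smooth lag windows (hypothesis 2: for
every smooth `φ` supported in `[−2,2]` and `c ≠ 0` there are `ϑ < 1/4`, `C` with
`|Σ_{j∈[1,2M]} φ((j−P)/D)·D(kj)| ≤ C·M^{3/4+ϑ}` for all `M`, `1 ≤ n ≠ n' ≤ 2M`, `k ≠ 0`,
`1 ≤ D ≤ Q/8`, `Q ≤ P ≤ 2Q`) imply: for every `c ≠ 0` there are `ϑ < 1/4` and `C` with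
`|R_k| ≤ C·M^{3/4+ϑ}` for all `M`, `1 ≤ n ≠ n' ≤ 2M`, `k ≠ 0` — the body of
`Summit.Parity.GeneralizedHardyLittlewood.Theses.LiouvilleMAD.FanDecorrelation`.
Bookkeeping: `ϑ = ϑ₀ + ε`, `ϑ₀ = max(ϑ₁,ϑ₂,0)`, `ε = (1/4 − ϑ₀)/2`,
`C = (4/(ε log 2) + 8)·max(C₁,C₂,0) + 36864`. [folklore] -/
theorem stub_transfer :
    (∃ φ₁ φ₂ : ℝ → ℝ, ContDiff ℝ (⊤ : ℕ∞) φ₁ ∧ ContDiff ℝ (⊤ : ℕ∞) φ₂ ∧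
      (∀ x : ℝ, φ₁ x ≠ 0 → |x| ≤ 2) ∧ (∀ x : ℝ, φ₂ x ≠ 0 → |x| ≤ 2) ∧
      ∀ Q : ℕ, 8 ≤ Q → ∃ N : ℕ, (2 : ℝ) ^ N ≤ Q ∧ ∃ s : ℕ → ℝ,
        (∀ i : ℕ, i < N → 1 ≤ s i ∧ 8 * s i ≤ Q) ∧
        ∀ j : ℤ, (if (Q : ℤ) ≤ j ∧ j < 2 * Q then (1 : ℝ) else 0) =
          (∑ i ∈ Finset.range N, φ₁ (((j : ℝ) - Q) / s i)) -
            (∑ i ∈ Finset.range N, φ₁ (((j : ℝ) - 2 * Q) / s i)) +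
            ∑ l ∈ Finset.range 8, φ₂ (((j : ℝ) - ((Q : ℝ) + l * ((Q : ℝ) / 8))) / ((Q : ℝ) / 8))) →
    (∀ φ : ℝ → ℝ, ContDiff ℝ (⊤ : ℕ∞) φ → (∀ x : ℝ, φ x ≠ 0 → |x| ≤ 2) →
      ∀ c : ℤ, c ≠ 0 → ∃ ϑ : ℝ, ϑ < 1 / 4 ∧ ∃ C : ℝ, ∀ M n n' : ℕ, ∀ k : ℤ, ∀ P D : ℝ,
        1 ≤ n → 1 ≤ n' → n ≠ n' → n ≤ 2 * M → n' ≤ 2 * M → k ≠ 0 →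
          1 ≤ D → 8 * D ≤ (Nat.sqrt M : ℝ) + 1 →
            (Nat.sqrt M : ℝ) + 1 ≤ P → P ≤ 2 * ((Nat.sqrt M : ℝ) + 1) →
              |∑ j ∈ Finset.Icc 1 (2 * M), φ (((j : ℝ) - P) / D) *
                  ∑ p ∈ (Finset.Ioc M (2 * M) ×ˢ Finset.Ioc M (2 * M)).filter
                      (fun p : ℕ × ℕ => (p.1 : ℤ) - p.2 = k * (j : ℤ)),
                    (ArithmeticFunction.liouville (Int.toNat ((p.1 : ℤ) * n + c)) : ℝ) *
                      (ArithmeticFunction.liouville (Int.toNat ((p.2 : ℤ) * n' + c)) : ℝ)| ≤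
                C * (M : ℝ) ^ (3 / 4 + ϑ)) →
    ∀ c : ℤ, c ≠ 0 → ∃ ϑ : ℝ, ϑ < 1 / 4 ∧ ∃ C : ℝ, ∀ M n n' : ℕ, ∀ k : ℤ,
      1 ≤ n → 1 ≤ n' → n ≠ n' → n ≤ 2 * M → n' ≤ 2 * M → k ≠ 0 →
        |∑ j ∈ Finset.Ico (Nat.sqrt M + 1) (2 * (Nat.sqrt M + 1)),
            ∑ p ∈ (Finset.Ioc M (2 * M) ×ˢ Finset.Ioc M (2 * M)).filter
                (fun p : ℕ × ℕ => (p.1 : ℤ) - p.2 = k * (j : ℤ)),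
              (ArithmeticFunction.liouville (Int.toNat ((p.1 : ℤ) * n + c)) : ℝ) *
                (ArithmeticFunction.liouville (Int.toNat ((p.2 : ℤ) * n' + c)) : ℝ)| ≤
          C * (M : ℝ) ^ (3 / 4 + ϑ) := by
  rintro ⟨φ₁, φ₂, hφ₁, hφ₂, hs₁, hs₂, hpart⟩ hHL c hc
  obtain ⟨ϑ₁, hϑ₁, C₁, h₁⟩ := hHL φ₁ hφ₁ hs₁ c hc
  obtain ⟨ϑ₂, hϑ₂, C₂, h₂⟩ := hHL φ₂ hφ₂ hs₂ c hc
  -- exponents and constants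
  set ϑ₀ : ℝ := max (max ϑ₁ ϑ₂) 0 with hϑ₀_def
  have hϑ₀ : ϑ₀ < 1 / 4 := max_lt (max_lt hϑ₁ hϑ₂) (by norm_num)
  have hϑ₀0 : 0 ≤ ϑ₀ := le_max_right _ _
  set ε : ℝ := (1 / 4 - ϑ₀) / 2 with hε_def
  have hε : 0 < ε := by rw [hε_def]; linarith
  have hε1 : ε ≤ 1 := by rw [hε_def]; linarith
  set C₀ : ℝ := max (max C₁ C₂) 0 with hC₀_def
  have hC₀ : 0 ≤ C₀ := le_max_right _ _
  set K : ℝ := 4 / (ε * Real.log 2) + 8 with hK_def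
  have hK : 0 ≤ K := by
    have : 0 < Real.log 2 := Real.log_pos one_lt_two
    rw [hK_def]; positivity
  refine ⟨ϑ₀ + ε, by rw [hε_def]; linarith, K * C₀ + 36864, ?_⟩
  intro M n n' k hn hn' hnn' hnM hn'M hk
  -- the lag sequence `a j = D(kj)` and the two reference bounds
  set a : ℕ → ℝ := fun j => ∑ p ∈ (Finset.Ioc M (2 * M) ×ˢ Finset.Ioc M (2 * M)).filter
      (fun p : ℕ × ℕ => (p.1 : ℤ) - p.2 = k * (j : ℤ)),
    (ArithmeticFunction.liouville (Int.toNat ((p.1 : ℤ) * n + c)) : ℝ) *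
      (ArithmeticFunction.liouville (Int.toNat ((p.2 : ℤ) * n' + c)) : ℝ) with ha_def
  show |∑ j ∈ Ico (Nat.sqrt M + 1) (2 * (Nat.sqrt M + 1)), a j| ≤
    (K * C₀ + 36864) * (M : ℝ) ^ (3 / 4 + (ϑ₀ + ε))
  have hM1nat : 1 ≤ M := by omega
  have hM1 : (1 : ℝ) ≤ M := by exact_mod_cast hM1nat
  have hrpow1 : 1 ≤ (M : ℝ) ^ (3 / 4 + (ϑ₀ + ε)) :=
    Real.one_le_rpow hM1 (by linarith)
  by_cases hM : M < 64
  · -- small scales: trivial bound `Q·M² ≤ 9·63² ≤ 36864`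
    have htriv := Summit.Parity.GeneralizedHardyLittlewood.Theorems.FanDecorrelation.FanFromLaws.abs_fanSum_le
      c n n' M k
    have hQ : Nat.sqrt M + 1 ≤ 8 := by
      have : Nat.sqrt M < 8 := Nat.sqrt_lt'.mpr (by omega)
      omega
    have hQM : ((Nat.sqrt M + 1 : ℕ) : ℝ) * (M : ℝ) ^ 2 ≤ 36864 := by
      have h8 : ((Nat.sqrt M + 1 : ℕ) : ℝ) ≤ 8 := by exact_mod_cast hQ
      have hM64 : (M : ℝ) ≤ 64 := by exact_mod_cast hM.le
      have hM0 : (0 : ℝ) ≤ M := by positivity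
      calc ((Nat.sqrt M + 1 : ℕ) : ℝ) * (M : ℝ) ^ 2 ≤ 8 * (64 : ℝ) ^ 2 := by
            apply mul_le_mul h8 _ (by positivity) (by norm_num)
            exact pow_le_pow_left₀ hM0 hM64 2
        _ ≤ 36864 := by norm_num
    calc |∑ j ∈ Ico (Nat.sqrt M + 1) (2 * (Nat.sqrt M + 1)), a j|
        ≤ ((Nat.sqrt M + 1 : ℕ) : ℝ) * (M : ℝ) ^ 2 := htriv
      _ ≤ 36864 := hQM
      _ ≤ (K * C₀ + 36864) * 1 := by nlinarith
      _ ≤ (K * C₀ + 36864) * (M : ℝ) ^ (3 / 4 + (ϑ₀ + ε)) :=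
          mul_le_mul_of_nonneg_left hrpow1 (by positivity)
  · -- large scales: partition the window
    have hM' : 64 ≤ M := not_lt.mp hM
    have hsq8 : 8 ≤ Nat.sqrt M := by
      rw [Nat.le_sqrt]
      omega
    set Q : ℕ := Nat.sqrt M + 1 with hQ_def
    have hQ8 : 8 ≤ Q := by omega
    have hQreal : (Q : ℝ) = (Nat.sqrt M : ℝ) + 1 := by rw [hQ_def]; push_cast; ring
    have hQle : Q ≤ M := by
      have : Nat.sqrt M ≤ M := Nat.sqrt_le_self M
      have : Nat.sqrt M < M := by
        by_contra hge
        have hge' : M ≤ Nat.sqrt M := not_lt.mp hge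
        have hsq : Nat.sqrt M * Nat.sqrt M ≤ M := Nat.sqrt_le M
        nlinarith
      omega
    have hQM : 2 * Q ≤ 2 * M + 1 := by omega
    obtain ⟨N, hN, s, hs, hpartQ⟩ := hpart Q hQ8
    -- rewrite the fan sum through the partition
    rw [sum_Ico_eq_sum_Icc_ite a hQM, sum_ite_mul_eq_of_partition a φ₁ φ₂ Q M N s hpartQ]
    -- bounds for the three groups of smooth fans
    have hpow : ∀ {Cx ϑx : ℝ}, Cx ≤ C₀ → ϑx ≤ ϑ₀ →
        Cx * (M : ℝ) ^ (3 / 4 + ϑx) ≤ C₀ * (M : ℝ) ^ (3 / 4 + ϑ₀) := fun hCx hϑx =>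
      Summit.Parity.GeneralizedHardyLittlewood.Theorems.FanDecorrelation.FanFromLaws.const_rpow_le
        hM1 hCx hC₀ (by linarith)
    have hC₁ : C₁ ≤ C₀ := le_trans (le_max_left _ _) (le_max_left _ _)
    have hC₂ : C₂ ≤ C₀ := le_trans (le_max_right _ _) (le_max_left _ _)
    have hϑ₁' : ϑ₁ ≤ ϑ₀ := le_trans (le_max_left _ _) (le_max_left _ _)
    have hϑ₂' : ϑ₂ ≤ ϑ₀ := le_trans (le_max_right _ _) (le_max_left _ _)
    have hQP1 : (Nat.sqrt M : ℝ) + 1 ≤ (Q : ℝ) := hQreal.ge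
    have hQP2 : (Q : ℝ) ≤ 2 * ((Nat.sqrt M : ℝ) + 1) := by
      rw [hQreal]; linarith [show (0 : ℝ) ≤ Nat.sqrt M by positivity]
    have h2QP1 : (Nat.sqrt M : ℝ) + 1 ≤ 2 * (Q : ℝ) := by
      rw [hQreal]; linarith [show (0 : ℝ) ≤ Nat.sqrt M by positivity]
    have h2QP2 : 2 * (Q : ℝ) ≤ 2 * ((Nat.sqrt M : ℝ) + 1) := by rw [hQreal]
    -- group 1: left edge layers
    have hg1 : ∀ i, i < N → |∑ j ∈ Icc 1 (2 * M), φ₁ (((j : ℝ) - Q) / s i) * a j| ≤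
        C₀ * (M : ℝ) ^ (3 / 4 + ϑ₀) := by
      intro i hi
      obtain ⟨hsi1, hsi8⟩ := hs i hi
      have := h₁ M n n' k (Q : ℝ) (s i) hn hn' hnn' hnM hn'M hk hsi1 (by rw [← hQreal]; exact hsi8)
        hQP1 hQP2
      exact this.trans (hpow hC₁ hϑ₁')
    -- group 2: right edge layers
    have hg2 : ∀ i, i < N → |∑ j ∈ Icc 1 (2 * M), φ₁ (((j : ℝ) - 2 * Q) / s i) * a j| ≤
        C₀ * (M : ℝ) ^ (3 / 4 + ϑ₀) := by
      intro i hi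
      obtain ⟨hsi1, hsi8⟩ := hs i hi
      have := h₁ M n n' k (2 * (Q : ℝ)) (s i) hn hn' hnn' hnM hn'M hk hsi1
        (by rw [← hQreal]; exact hsi8) h2QP1 h2QP2
      exact this.trans (hpow hC₁ hϑ₁')
    -- group 3: interior tiles
    have hg3 : ∀ l : ℕ, l < 8 →
        |∑ j ∈ Icc 1 (2 * M), φ₂ (((j : ℝ) - ((Q : ℝ) + (l : ℝ) * ((Q : ℝ) / 8))) / ((Q : ℝ) / 8)) *
          a j| ≤ C₀ * (M : ℝ) ^ (3 / 4 + ϑ₀) := by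
      intro l hl
      have hl7nat : l ≤ 7 := by omega
      have hl7 : (l : ℝ) ≤ 7 := by exact_mod_cast hl7nat
      have hl0 : (0 : ℝ) ≤ (l : ℝ) := by positivity
      have hQ8r : (8 : ℝ) ≤ Q := by exact_mod_cast hQ8
      have hD1 : (1 : ℝ) ≤ (Q : ℝ) / 8 := by rw [le_div_iff₀ (by norm_num)]; linarith
      have hD8 : 8 * ((Q : ℝ) / 8) ≤ (Nat.sqrt M : ℝ) + 1 := by rw [← hQreal]; linarith
      have hPlo : (Nat.sqrt M : ℝ) + 1 ≤ (Q : ℝ) + l * ((Q : ℝ) / 8) := by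
        rw [← hQreal]; nlinarith
      have hPhi : (Q : ℝ) + l * ((Q : ℝ) / 8) ≤ 2 * ((Nat.sqrt M : ℝ) + 1) := by
        rw [← hQreal]; nlinarith
      have := h₂ M n n' k ((Q : ℝ) + l * ((Q : ℝ) / 8)) ((Q : ℝ) / 8) hn hn' hnn' hnM hn'M hk
        hD1 hD8 hPlo hPhi
      exact this.trans (hpow hC₂ hϑ₂')
    -- count the pieces
    have hcount : 2 * (N : ℝ) + 8 ≤ K * (M : ℝ) ^ ε := by
      have hQ2M : (Q : ℝ) ≤ 2 * M := by
        have : (Q : ℝ) ≤ M := by exact_mod_cast hQle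
        linarith
      exact two_mul_add_eight_le hN hQ2M hM1 hε hε1
    have hB0 : 0 ≤ C₀ * (M : ℝ) ^ (3 / 4 + ϑ₀) := mul_nonneg hC₀ (Real.rpow_nonneg (by positivity) _)
    have hsplit : (M : ℝ) ^ (3 / 4 + (ϑ₀ + ε)) = (M : ℝ) ^ ε * (M : ℝ) ^ (3 / 4 + ϑ₀) := by
      rw [← Real.rpow_add (by positivity)]; ring_nf
    calc |(∑ i ∈ range N, ∑ j ∈ Icc 1 (2 * M), φ₁ (((j : ℝ) - Q) / s i) * a j) -
            (∑ i ∈ range N, ∑ j ∈ Icc 1 (2 * M), φ₁ (((j : ℝ) - 2 * Q) / s i) * a j) +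
            ∑ l ∈ range 8, ∑ j ∈ Icc 1 (2 * M),
              φ₂ (((j : ℝ) - ((Q : ℝ) + l * ((Q : ℝ) / 8))) / ((Q : ℝ) / 8)) * a j|
        ≤ |∑ i ∈ range N, ∑ j ∈ Icc 1 (2 * M), φ₁ (((j : ℝ) - Q) / s i) * a j| +
            |∑ i ∈ range N, ∑ j ∈ Icc 1 (2 * M), φ₁ (((j : ℝ) - 2 * Q) / s i) * a j| +
            |∑ l ∈ range 8, ∑ j ∈ Icc 1 (2 * M),
              φ₂ (((j : ℝ) - ((Q : ℝ) + l * ((Q : ℝ) / 8))) / ((Q : ℝ) / 8)) * a j| :=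
          (abs_add_le _ _).trans (by gcongr; exact abs_sub _ _)
      _ ≤ N * (C₀ * (M : ℝ) ^ (3 / 4 + ϑ₀)) + N * (C₀ * (M : ℝ) ^ (3 / 4 + ϑ₀)) +
            8 * (C₀ * (M : ℝ) ^ (3 / 4 + ϑ₀)) := by
          gcongr
          · exact abs_sum_range_le hg1
          · exact abs_sum_range_le hg2
          · exact_mod_cast abs_sum_range_le hg3
      _ = (2 * (N : ℝ) + 8) * (C₀ * (M : ℝ) ^ (3 / 4 + ϑ₀)) := by ring
      _ ≤ (K * (M : ℝ) ^ ε) * (C₀ * (M : ℝ) ^ (3 / 4 + ϑ₀)) :=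
          mul_le_mul_of_nonneg_right hcount hB0
      _ = K * C₀ * (M : ℝ) ^ (3 / 4 + (ϑ₀ + ε)) := by rw [hsplit]; ring
      _ ≤ (K * C₀ + 36864) * (M : ℝ) ^ (3 / 4 + (ϑ₀ + ε)) := by
          apply mul_le_mul_of_nonneg_right (by linarith) (by positivity)

end Summit.Parity.GeneralizedHardyLittlewood.Theorems.FanDecorrelation.Transfer
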